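import Summits.QuantumFields.YangMills.Theorems.LuscherReductionTwistedTraceScalingCovariantCurl
import Summits.QuantumFields.YangMills.Theorems.LuscherReductionTwistedTraceScalingAdjointRotationAlgebra
import HarnessLib

/-!
# Covariance of the covariant curl: `D_{U^g}(Ad(g)w) = Ad(g)·D_U w` (brick c2 part ii)
# (lane B of S-BASE, crux `TwistedTraceScaling` stmt-QuantumFields-20203; covariant reformulation of the Laplace step, blueprint §5–§6)

Under `U ↦ U^g` the partial holonomies transform as parallel transports, `P ↦ g_x P g_y⁻¹` (`y` the far end point), and the plaquette holonomy is
conjugated at the base point.  With `Ad(AB) = Ad(A)Ad(B)`, `Ad(A⁻¹) = Ad(A)ᵀ` (`…AdjointRotationAlgebra`) the four terms of `(D_U w)_p` rotate by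
`Ad(g_{x_p})` when the step coordinates rotate by `Ad(g_{x_e})` at their own base points (`rotLink`): `covCurl_gaugeTransform`.  Consequently the normal
modes of `D_U†D_U` are gauge invariant (successor: unitary equivalence, `Λ(U^g) = Λ(U)`).
HONEST FRAMING: algebra; femto rung R2b1 (stub of a child of a CONDITIONAL route); not a gap, not Clay.
-/

set_option autoImplicit false

noncomputable section

open scoped Matrix BigOperators
open Literature.MathematicalPhysics.QuantumFieldTheory
open Literature.MathematicalPhysics.QuantumLattice

namespace Summit.QuantumFields.YangMills.Theorems.FemtoTransferGap.TwoLattice.Cov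

open Summit.QuantumFields.YangMills.Theorems.FemtoTransferGap
open Summit.QuantumFields.YangMills.Theorems.FemtoTransferGap.TwoLattice
open Summit.QuantumFields.YangMills.Theorems.FemtoTransferGap.TwoLattice.Stiff

variable {L : ℕ} [NeZero L]

/-! ## §1 Partial holonomies under gauge transformations -/

omit [NeZero L] in
/-- `P₁(U^g) = g_x P₁(U) g_{x+eᵢ}⁻¹`. [folklore] -/
theorem ptrans1_gaugeTransform (g : Site 3 L → SU2) (U : GaugeConfig 3 L SU2) (p : Plaquette 3 L) :
    ptrans1 (gaugeTransform g U) p = g p.1 * ptrans1 U p * (g (p.1.shift p.2.1.1))⁻¹ := by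
  simp only [ptrans1, gaugeTransform]

omit [NeZero L] in
/-- `P₂(U^g) = g_x P₂(U) g_{x+eⱼ}⁻¹`. [folklore] -/
theorem ptrans2_gaugeTransform (g : Site 3 L → SU2) (U : GaugeConfig 3 L SU2) (p : Plaquette 3 L) :
    ptrans2 (gaugeTransform g U) p = g p.1 * ptrans2 U p * (g (p.1.shift p.2.1.2))⁻¹ := by
  have hshift : (p.1.shift p.2.1.2).shift p.2.1.1 = (p.1.shift p.2.1.1).shift p.2.1.2 := shift_shift_comm L p.1 p.2.1.2 p.2.1.1
  simp only [ptrans2, gaugeTransform, hshift, mul_inv_rev, inv_inv]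
  group

/-! ## §2 Rotated link coordinates and the covariance identity -/

/-- Matrix identity behind covariance: `Ad(g_x P g_y⁻¹)·(Ad(g_y) v) = Ad(g_x)·(Ad(P) v)`. [folklore] -/
theorem adRot_transport_mulVec (gx P gy : SU2) (v : Fin 3 → ℝ) :
    (adRot (gx * P * gy⁻¹)).mulVec ((adRot gy).mulVec v) = (adRot gx).mulVec ((adRot P).mulVec v) := by
  simp only [adRot_mul, adRot_inv, Matrix.mulVec_mulVec]
  rw [Matrix.mul_assoc (adRot gx * adRot P), adRot_transpose_mul_self, Matrix.mul_one]

/-- Rotation of step coordinates at their base points: `(rotLink g w)(e, ·) = Ad(g_{x_e}) w(e, ·)`. [folklore] -/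
def rotLink (g : Site 3 L → SU2) (w : LinkSpace L) : LinkSpace L :=
  WithLp.toLp 2 fun ea : Edge 3 L × Fin 3 => (adRot (g ea.1.1)).mulVec (fun b => w (ea.1, b)) ea.2

omit [NeZero L] in
/-- Components of `rotLink`. [folklore] -/
@[simp] theorem rotLink_apply (g : Site 3 L → SU2) (w : LinkSpace L) (e : Edge 3 L) (a : Fin 3) :
    rotLink g w (e, a) = (adRot (g e.1)).mulVec (fun b => w (e, b)) a := rfl

omit [NeZero L] in
/-- ★ **COVARIANCE OF THE COVARIANT CURL**: `(D_{U^g}(rotLink g w))_p = Ad(g_{x_p}) · (D_U w)_p`. [cite: Luscher1983, §3] -/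
theorem covCurl_gaugeTransform (g : Site 3 L → SU2) (U : GaugeConfig 3 L SU2) (w : LinkSpace L) (p : Plaquette 3 L) (a : Fin 3) :
    covCurl (gaugeTransform g U) (rotLink g w) (p, a) = (adRot (g p.1)).mulVec (fun b => covCurl U w (p, b)) a := by
  obtain ⟨x, ij⟩ := p
  -- left side: the four terms with transformed transports
  rw [covCurl_apply]
  have h1 := ptrans1_gaugeTransform g U (x, ij)
  have h2 := ptrans2_gaugeTransform g U (x, ij)
  have h3 : hol (gaugeTransform g U) (x, ij) = g x * hol U (x, ij) * (g x)⁻¹ := hol_gaugeTransform g U (x, ij)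
  simp only at h1 h2
  rw [h1, h2, h3]
  -- each transported term: `Ad(g_x P g_y⁻¹)(Ad(g_y) w_e) = Ad(g_x)(Ad(P) w_e)`
  have t2 : (adRot (g x * ptrans1 U (x, ij) * (g (x.shift ij.1.1))⁻¹)).mulVec (fun b => rotLink g w ((x.shift ij.1.1, ij.1.2), b)) =
      (adRot (g x)).mulVec ((adRot (ptrans1 U (x, ij))).mulVec fun b => w ((x.shift ij.1.1, ij.1.2), b)) := by
    have : (fun b => rotLink g w ((x.shift ij.1.1, ij.1.2), b)) = (adRot (g (x.shift ij.1.1))).mulVec fun b => w ((x.shift ij.1.1, ij.1.2), b) :=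
      funext fun b => rfl
    rw [this, adRot_transport_mulVec]
  have t3 : (adRot (g x * ptrans2 U (x, ij) * (g (x.shift ij.1.2))⁻¹)).mulVec (fun b => rotLink g w ((x.shift ij.1.2, ij.1.1), b)) =
      (adRot (g x)).mulVec ((adRot (ptrans2 U (x, ij))).mulVec fun b => w ((x.shift ij.1.2, ij.1.1), b)) := by
    have : (fun b => rotLink g w ((x.shift ij.1.2, ij.1.1), b)) = (adRot (g (x.shift ij.1.2))).mulVec fun b => w ((x.shift ij.1.2, ij.1.1), b) :=
      funext fun b => rfl
    rw [this, adRot_transport_mulVec]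
  have t4 : (adRot (g x * hol U (x, ij) * (g x)⁻¹)).mulVec (fun b => rotLink g w ((x, ij.1.2), b)) =
      (adRot (g x)).mulVec ((adRot (hol U (x, ij))).mulVec fun b => w ((x, ij.1.2), b)) := by
    have : (fun b => rotLink g w ((x, ij.1.2), b)) = (adRot (g x)).mulVec fun b => w ((x, ij.1.2), b) := funext fun b => rfl
    rw [this, adRot_transport_mulVec]
  have t1 : rotLink g w ((x, ij.1.1), a) = (adRot (g x)).mulVec (fun b => w ((x, ij.1.1), b)) a := rfl
  -- rewrite the sums as `mulVec` components and conclude by linearity of `Ad(g_x)`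
  have eq2 : ∑ b, adRot (g x * ptrans1 U (x, ij) * (g (x.shift ij.1.1))⁻¹) a b * rotLink g w ((x.shift ij.1.1, ij.1.2), b) =
      (adRot (g x)).mulVec ((adRot (ptrans1 U (x, ij))).mulVec fun b => w ((x.shift ij.1.1, ij.1.2), b)) a := by
    rw [← t2]; rfl
  have eq3 : ∑ b, adRot (g x * ptrans2 U (x, ij) * (g (x.shift ij.1.2))⁻¹) a b * rotLink g w ((x.shift ij.1.2, ij.1.1), b) =
      (adRot (g x)).mulVec ((adRot (ptrans2 U (x, ij))).mulVec fun b => w ((x.shift ij.1.2, ij.1.1), b)) a := by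
    rw [← t3]; rfl
  have eq4 : ∑ b, adRot (g x * hol U (x, ij) * (g x)⁻¹) a b * rotLink g w ((x, ij.1.2), b) =
      (adRot (g x)).mulVec ((adRot (hol U (x, ij))).mulVec fun b => w ((x, ij.1.2), b)) a := by
    rw [← t4]; rfl
  rw [t1, eq2, eq3, eq4]
  -- right side
  have hr : (fun b => covCurl U w ((x, ij), b)) = (fun b => w ((x, ij.1.1), b)) +
      (adRot (ptrans1 U (x, ij))).mulVec (fun b => w ((x.shift ij.1.1, ij.1.2), b)) -
      (adRot (ptrans2 U (x, ij))).mulVec (fun b => w ((x.shift ij.1.2, ij.1.1), b)) -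
      (adRot (hol U (x, ij))).mulVec (fun b => w ((x, ij.1.2), b)) := by
    funext b
    rw [covCurl_apply]
    simp only [Pi.add_apply, Pi.sub_apply, Matrix.mulVec, dotProduct]
  rw [hr, Matrix.mulVec_sub, Matrix.mulVec_sub, Matrix.mulVec_add]
  simp only [Pi.add_apply, Pi.sub_apply]

end Summit.QuantumFields.YangMills.Theorems.FemtoTransferGap.TwoLattice.Cov

end
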